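import Summits.Ventures.Crystal3D.Theorems.StickyWulffConstantNoReconstructionGainCubicActions
import Summits.Ventures.Crystal3D.Theorems.StickyWulffConstantNoReconstructionGainCubicFrame
import Summits.Ventures.Crystal3D.Theorems.StickyWulffConstantGenericWallFloorSlotSum
import Summits.Ventures.Crystal3D.Theorems.StickyWulffConstantGenericWallFloorGrainCredits
import HarnessLib

/-!
# Face classes of the slot cuboctahedron in cubic coordinates (for the axis rule of translation pairs)

HONEST FRAMING. Part of the venture `Summits/Ventures/Crystal3D` (cell `crystal3d-full`), helper
`--supports` the crux `CoaxialWallLaw` (stmt-Ventures-19481, `route-Ventures-StickyWulffConstant`),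
REGISTERED line `WallLedgerF` (planner cf-p1 gen 16), stub `stub_coaxialTwoSlabAdhesion`.
Infrastructure for the ADAPTED FRAME of a translation pair (line card WallLedger.md, addendum A:
the axis rule): the translation rung `coaxialTwoSlabAdhesion_rigid_translate` carries the hypothesis
that no LATERAL triangular face `{w₁, w₂, w₃}` of the slot cuboctahedron (one with a horizontal
vertex) has its twin class `(2/3)(w₁ + w₂ + w₃)` congruent to the offset mod `Λ₀`; the next file
shows that some frame of the same lattice always satisfies it.  Here, in the cubic coordinates
`A, B, C` of `…NoReconstructionGainCubicFrame` (passed as functions with their defining formulas,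
as in `cubic_actions`):

* `cubic_add`, `cubic_smul`, `cubic_int_of_mem_fcc` — linearity; lattice points have integer
  cubic coordinates;
* `cubic_slot_mem_list` — a slot has cubic coordinates in the twelve `(±1, ±1, 0)`-type triples;
  `cubic_dot_of_dist_eq_one` — touching slots have cubic dot product `1`;
* `cubicShell_faceSum` (kernel `decide`) — three pairwise touching slots have coordinate sums
  `(±2, ±2, ±2)`: the face sum is `2ε`, `ε ∈ {±1}³` (the eight `⟨111⟩` classes);
* `apply_two_eq_cubic` — `p₂ = (−A p + B p + C p)/(3√(2/3))`; `abs_faceSum_apply_two_le` — a face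
  with a horizontal vertex has `|(w₁+w₂+w₃)₂| ≤ 2√(2/3)`, so its cubic sum is not `±(−2, 2, 2)`
  (`faceSum_not_vertical`).

WHAT THIS IS NOT: the adapted frame itself (next file), the stub; rung F-C1 not moved.
-/

noncomputable section

namespace Summit.Ventures.Crystal3D.Theorems

open Summit.Ventures.Crystal3D Finset
open Literature.MathematicalPhysics.StatisticalMechanics (barlowPos barlowStacking fccStacking
  constHagg barlowPos_mem barlowPos_apply_two)
open scoped InnerProductSpace

/-! ## Linearity and integrality of the cubic coordinates -/

/-- The cubic coordinates are additive. -/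
theorem cubic_add (F : EuclideanSpace ℝ (Fin 3) → ℝ) (a b c : ℝ)
    (hF : ∀ x, F x = a * x 0 + b * x 1 + c * x 2) (x y : EuclideanSpace ℝ (Fin 3)) :
    F (x + y) = F x + F y := by
  rw [hF, hF, hF]; simp only [PiLp.add_apply]; ring

/-- The cubic coordinates are homogeneous. -/
theorem cubic_smul (F : EuclideanSpace ℝ (Fin 3) → ℝ) (a b c : ℝ)
    (hF : ∀ x, F x = a * x 0 + b * x 1 + c * x 2) (r : ℝ) (x : EuclideanSpace ℝ (Fin 3)) :
    F (r • x) = r * F x := by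
  rw [hF, hF]; simp only [PiLp.smul_apply, smul_eq_mul]; ring

/-- **Lattice points have integer cubic coordinates** (`cubic_barlowPos`). -/
theorem cubic_int_of_mem_fcc (A B C : EuclideanSpace ℝ (Fin 3) → ℝ)
    (hA : ∀ x, A x = x 0 + Real.sqrt 3 / 3 * x 1 - Real.sqrt (2 / 3) * x 2)
    (hB : ∀ x, B x = x 0 - Real.sqrt 3 / 3 * x 1 + Real.sqrt (2 / 3) * x 2)
    (hC : ∀ x, C x = 2 * Real.sqrt 3 / 3 * x 1 + Real.sqrt (2 / 3) * x 2)
    {p : EuclideanSpace ℝ (Fin 3)} (hp : p ∈ fccStacking 1 (Real.sqrt (2 / 3))) :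
    ∃ a b c : ℤ, A p = a ∧ B p = b ∧ C p = c := by
  obtain ⟨k, i, j, rfl⟩ := hp
  obtain ⟨h1, h2, h3⟩ := cubic_barlowPos k i j
  refine ⟨i + j, i + k, j + k, ?_, ?_, ?_⟩
  · rw [hA]; push_cast; linarith
  · rw [hB]; push_cast; linarith
  · rw [hC]; push_cast; linarith

/-- `p₂` from the cubic coordinates: `3 √(2/3) p₂ = −A p + B p + C p`. -/
theorem apply_two_eq_cubic (A B C : EuclideanSpace ℝ (Fin 3) → ℝ)
    (hA : ∀ x, A x = x 0 + Real.sqrt 3 / 3 * x 1 - Real.sqrt (2 / 3) * x 2)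
    (hB : ∀ x, B x = x 0 - Real.sqrt 3 / 3 * x 1 + Real.sqrt (2 / 3) * x 2)
    (hC : ∀ x, C x = 2 * Real.sqrt 3 / 3 * x 1 + Real.sqrt (2 / 3) * x 2)
    (p : EuclideanSpace ℝ (Fin 3)) :
    3 * Real.sqrt (2 / 3) * p 2 = -A p + B p + C p := by
  rw [hA, hB, hC]; ring

/-- A vector with vanishing cubic coordinates is zero (`2‖p‖² = A² + B² + C²`). -/
theorem eq_zero_of_cubic_zero (A B C : EuclideanSpace ℝ (Fin 3) → ℝ)
    (hA : ∀ x, A x = x 0 + Real.sqrt 3 / 3 * x 1 - Real.sqrt (2 / 3) * x 2)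
    (hB : ∀ x, B x = x 0 - Real.sqrt 3 / 3 * x 1 + Real.sqrt (2 / 3) * x 2)
    (hC : ∀ x, C x = 2 * Real.sqrt 3 / 3 * x 1 + Real.sqrt (2 / 3) * x 2)
    {p : EuclideanSpace ℝ (Fin 3)} (h0 : A p = 0) (h1 : B p = 0) (h2 : C p = 0) : p = 0 := by
  have h := two_mul_norm_sq_eq_cubic p
  rw [← hA, ← hB, ← hC, h0, h1, h2] at h
  have : ‖p‖ ^ 2 = 0 := by nlinarith
  exact norm_eq_zero.1 (pow_eq_zero_iff (n := 2) (by norm_num) |>.1 this)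

/-! ## Slots and faces in cubic coordinates -/

/-- **Slots have cubic coordinates of type `(±1, ±1, 0)`.** -/
theorem cubic_slot_mem_list (A B C : EuclideanSpace ℝ (Fin 3) → ℝ)
    (hA : ∀ x, A x = x 0 + Real.sqrt 3 / 3 * x 1 - Real.sqrt (2 / 3) * x 2)
    (hB : ∀ x, B x = x 0 - Real.sqrt 3 / 3 * x 1 + Real.sqrt (2 / 3) * x 2)
    (hC : ∀ x, C x = 2 * Real.sqrt 3 / 3 * x 1 + Real.sqrt (2 / 3) * x 2)
    {w : EuclideanSpace ℝ (Fin 3)} (hw : w ∈ fccSlots) :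
    ∃ v ∈ ([((1 : ℤ), (1 : ℤ), (0 : ℤ)), (1, -1, 0), (-1, 1, 0), (-1, -1, 0), (1, 0, 1), (1, 0, -1),
      (-1, 0, 1), (-1, 0, -1), (0, 1, 1), (0, 1, -1), (0, -1, 1), (0, -1, -1)] : List (ℤ × ℤ × ℤ)),
      A w = v.1 ∧ B w = v.2.1 ∧ C w = v.2.2 := by
  rw [fccSlots, Finset.mem_image] at hw
  obtain ⟨c, hc, rfl⟩ := hw
  obtain ⟨h1, h2, h3⟩ := cubic_barlowPos c.1 c.2.1 c.2.2
  have hA' : A (barlowPos 1 (Real.sqrt (2 / 3)) constHagg c.1 c.2.1 c.2.2) = c.2.1 + c.2.2 := by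
    rw [hA]; linarith
  have hB' : B (barlowPos 1 (Real.sqrt (2 / 3)) constHagg c.1 c.2.1 c.2.2) = c.2.1 + c.1 := by
    rw [hB]; linarith
  have hC' : C (barlowPos 1 (Real.sqrt (2 / 3)) constHagg c.1 c.2.1 c.2.2) = c.2.2 + c.1 := by
    rw [hC]; linarith
  rw [hA', hB', hC']
  refine ⟨(c.2.1 + c.2.2, c.2.1 + c.1, c.2.2 + c.1), ?_, by push_cast; ring, by push_cast; ring,
    by push_cast; ring⟩
  simp only [fccSlotTriples, Finset.mem_insert, Finset.mem_singleton] at hc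
  rcases hc with rfl | rfl | rfl | rfl | rfl | rfl | rfl | rfl | rfl | rfl | rfl | rfl <;> decide

/-- **Touching slots have cubic dot product `1`** (`2⟪w, w'⟫ = A A' + B B' + C C'`). -/
theorem cubic_dot_of_dist_eq_one (A B C : EuclideanSpace ℝ (Fin 3) → ℝ)
    (hA : ∀ x, A x = x 0 + Real.sqrt 3 / 3 * x 1 - Real.sqrt (2 / 3) * x 2)
    (hB : ∀ x, B x = x 0 - Real.sqrt 3 / 3 * x 1 + Real.sqrt (2 / 3) * x 2)
    (hC : ∀ x, C x = 2 * Real.sqrt 3 / 3 * x 1 + Real.sqrt (2 / 3) * x 2)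
    {w w' : EuclideanSpace ℝ (Fin 3)} (hw : ‖w‖ = 1) (hw' : ‖w'‖ = 1) (hd : dist w w' = 1) :
    A w * A w' + B w * B w' + C w * C w' = 1 := by
  have h1 := two_mul_norm_sq_eq_cubic w
  have h2 := two_mul_norm_sq_eq_cubic w'
  have h3 := two_mul_norm_sq_eq_cubic (w - w')
  rw [← hA, ← hB, ← hC] at h1 h2 h3
  rw [← dist_eq_norm, hd] at h3
  rw [hw] at h1; rw [hw'] at h2
  have eA : A (w - w') = A w - A w' := by rw [hA, hA, hA]; simp only [PiLp.sub_apply]; ring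
  have eB : B (w - w') = B w - B w' := by rw [hB, hB, hB]; simp only [PiLp.sub_apply]; ring
  have eC : C (w - w') = C w - C w' := by rw [hC, hC, hC]; simp only [PiLp.sub_apply]; ring
  rw [eA, eB, eC] at h3
  nlinarith

/-- Face sums in cubic coordinates (Boolean form, kernel `decide`): three list vectors with
pairwise dot product `1` have coordinate sums in `{2, −2}`. -/
theorem cubicShell_faceSumB :
    (([((1 : ℤ), (1 : ℤ), (0 : ℤ)), (1, -1, 0), (-1, 1, 0), (-1, -1, 0), (1, 0, 1), (1, 0, -1), (-1, 0, 1), (-1, 0, -1), (0, 1, 1), (0, 1, -1), (0, -1, 1), (0, -1, -1)] : List (ℤ × ℤ × ℤ)).all fun v₁ =>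
      ([((1 : ℤ), (1 : ℤ), (0 : ℤ)), (1, -1, 0), (-1, 1, 0), (-1, -1, 0), (1, 0, 1), (1, 0, -1), (-1, 0, 1), (-1, 0, -1), (0, 1, 1), (0, 1, -1), (0, -1, 1), (0, -1, -1)] : List (ℤ × ℤ × ℤ)).all fun v₂ =>
      ([((1 : ℤ), (1 : ℤ), (0 : ℤ)), (1, -1, 0), (-1, 1, 0), (-1, -1, 0), (1, 0, 1), (1, 0, -1), (-1, 0, 1), (-1, 0, -1), (0, 1, 1), (0, 1, -1), (0, -1, 1), (0, -1, -1)] : List (ℤ × ℤ × ℤ)).all fun v₃ =>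
        !decide (v₁.1 * v₂.1 + v₁.2.1 * v₂.2.1 + v₁.2.2 * v₂.2.2 = 1) ||
        !decide (v₁.1 * v₃.1 + v₁.2.1 * v₃.2.1 + v₁.2.2 * v₃.2.2 = 1) ||
        !decide (v₂.1 * v₃.1 + v₂.2.1 * v₃.2.1 + v₂.2.2 * v₃.2.2 = 1) ||
        ((decide (v₁.1 + v₂.1 + v₃.1 = 2) || decide (v₁.1 + v₂.1 + v₃.1 = -2)) &&
          (decide (v₁.2.1 + v₂.2.1 + v₃.2.1 = 2) || decide (v₁.2.1 + v₂.2.1 + v₃.2.1 = -2)) &&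
          (decide (v₁.2.2 + v₂.2.2 + v₃.2.2 = 2) || decide (v₁.2.2 + v₂.2.2 + v₃.2.2 = -2)))) = true := by
  decide +kernel

/-- **Face sums are `(±2, ±2, ±2)` in cubic coordinates.** -/
theorem cubicShell_faceSum :
    ∀ v₁ ∈ ([((1 : ℤ), (1 : ℤ), (0 : ℤ)), (1, -1, 0), (-1, 1, 0), (-1, -1, 0), (1, 0, 1), (1, 0, -1), (-1, 0, 1), (-1, 0, -1), (0, 1, 1), (0, 1, -1), (0, -1, 1), (0, -1, -1)] : List (ℤ × ℤ × ℤ)),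
    ∀ v₂ ∈ ([((1 : ℤ), (1 : ℤ), (0 : ℤ)), (1, -1, 0), (-1, 1, 0), (-1, -1, 0), (1, 0, 1), (1, 0, -1), (-1, 0, 1), (-1, 0, -1), (0, 1, 1), (0, 1, -1), (0, -1, 1), (0, -1, -1)] : List (ℤ × ℤ × ℤ)),
    ∀ v₃ ∈ ([((1 : ℤ), (1 : ℤ), (0 : ℤ)), (1, -1, 0), (-1, 1, 0), (-1, -1, 0), (1, 0, 1), (1, 0, -1), (-1, 0, 1), (-1, 0, -1), (0, 1, 1), (0, 1, -1), (0, -1, 1), (0, -1, -1)] : List (ℤ × ℤ × ℤ)),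
      v₁.1 * v₂.1 + v₁.2.1 * v₂.2.1 + v₁.2.2 * v₂.2.2 = 1 → v₁.1 * v₃.1 + v₁.2.1 * v₃.2.1 + v₁.2.2 * v₃.2.2 = 1 →
      v₂.1 * v₃.1 + v₂.2.1 * v₃.2.1 + v₂.2.2 * v₃.2.2 = 1 →
      (v₁.1 + v₂.1 + v₃.1 = 2 ∨ v₁.1 + v₂.1 + v₃.1 = -2) ∧
      (v₁.2.1 + v₂.2.1 + v₃.2.1 = 2 ∨ v₁.2.1 + v₂.2.1 + v₃.2.1 = -2) ∧
      (v₁.2.2 + v₂.2.2 + v₃.2.2 = 2 ∨ v₁.2.2 + v₂.2.2 + v₃.2.2 = -2) := by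
  have h := cubicShell_faceSumB
  simp only [List.all_eq_true, Bool.or_eq_true, Bool.and_eq_true, Bool.not_eq_true',
    decide_eq_true_eq, decide_eq_false_iff_not] at h
  intro v₁ hv₁ v₂ hv₂ v₃ hv₃ d12 d13 d23
  rcases h v₁ hv₁ v₂ hv₂ v₃ hv₃ with ((h | h) | h) | h
  · exact absurd d12 h
  · exact absurd d13 h
  · exact absurd d23 h
  · exact ⟨h.1.1, h.1.2, h.2⟩

/-- **The face sum of three pairwise touching slots is `2ε` in cubic coordinates.** -/
theorem faceSum_cubic (A B C : EuclideanSpace ℝ (Fin 3) → ℝ)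
    (hA : ∀ x, A x = x 0 + Real.sqrt 3 / 3 * x 1 - Real.sqrt (2 / 3) * x 2)
    (hB : ∀ x, B x = x 0 - Real.sqrt 3 / 3 * x 1 + Real.sqrt (2 / 3) * x 2)
    (hC : ∀ x, C x = 2 * Real.sqrt 3 / 3 * x 1 + Real.sqrt (2 / 3) * x 2)
    {w₁ w₂ w₃ : EuclideanSpace ℝ (Fin 3)} (h₁ : w₁ ∈ fccSlots) (h₂ : w₂ ∈ fccSlots) (h₃ : w₃ ∈ fccSlots)
    (d12 : dist w₁ w₂ = 1) (d13 : dist w₁ w₃ = 1) (d23 : dist w₂ w₃ = 1) :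
    (A (w₁ + w₂ + w₃) = 2 ∨ A (w₁ + w₂ + w₃) = -2) ∧ (B (w₁ + w₂ + w₃) = 2 ∨ B (w₁ + w₂ + w₃) = -2) ∧
      (C (w₁ + w₂ + w₃) = 2 ∨ C (w₁ + w₂ + w₃) = -2) := by
  obtain ⟨v₁, hv₁, a1, b1, c1⟩ := cubic_slot_mem_list A B C hA hB hC h₁
  obtain ⟨v₂, hv₂, a2, b2, c2⟩ := cubic_slot_mem_list A B C hA hB hC h₂
  obtain ⟨v₃, hv₃, a3, b3, c3⟩ := cubic_slot_mem_list A B C hA hB hC h₃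
  have n₁ := norm_eq_one_of_mem_fccSlots h₁
  have n₂ := norm_eq_one_of_mem_fccSlots h₂
  have n₃ := norm_eq_one_of_mem_fccSlots h₃
  have e12 := cubic_dot_of_dist_eq_one A B C hA hB hC n₁ n₂ d12
  have e13 := cubic_dot_of_dist_eq_one A B C hA hB hC n₁ n₃ d13
  have e23 := cubic_dot_of_dist_eq_one A B C hA hB hC n₂ n₃ d23
  rw [a1, b1, c1, a2, b2, c2] at e12
  rw [a1, b1, c1, a3, b3, c3] at e13
  rw [a2, b2, c2, a3, b3, c3] at e23
  have i12 : v₁.1 * v₂.1 + v₁.2.1 * v₂.2.1 + v₁.2.2 * v₂.2.2 = 1 := by exact_mod_cast e12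
  have i13 : v₁.1 * v₃.1 + v₁.2.1 * v₃.2.1 + v₁.2.2 * v₃.2.2 = 1 := by exact_mod_cast e13
  have i23 : v₂.1 * v₃.1 + v₂.2.1 * v₃.2.1 + v₂.2.2 * v₃.2.2 = 1 := by exact_mod_cast e23
  obtain ⟨hs1, hs2, hs3⟩ := cubicShell_faceSum v₁ hv₁ v₂ hv₂ v₃ hv₃ i12 i13 i23
  have eA : A (w₁ + w₂ + w₃) = A w₁ + A w₂ + A w₃ := by
    rw [hA, hA, hA, hA]; simp only [PiLp.add_apply]; ring
  have eB : B (w₁ + w₂ + w₃) = B w₁ + B w₂ + B w₃ := by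
    rw [hB, hB, hB, hB]; simp only [PiLp.add_apply]; ring
  have eC : C (w₁ + w₂ + w₃) = C w₁ + C w₂ + C w₃ := by
    rw [hC, hC, hC, hC]; simp only [PiLp.add_apply]; ring
  rw [eA, eB, eC, a1, a2, a3, b1, b2, b3, c1, c2, c3]
  refine ⟨?_, ?_, ?_⟩
  · rcases hs1 with h | h
    · left; exact_mod_cast h
    · right; exact_mod_cast h
  · rcases hs2 with h | h
    · left; exact_mod_cast h
    · right; exact_mod_cast h
  · rcases hs3 with h | h
    · left; exact_mod_cast h
    · right; exact_mod_cast h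

/-! ## Lateral faces are not vertical -/

/-- A slot has `|w₂| ≤ √(2/3)`. -/
theorem abs_apply_two_le_of_mem_fccSlots {w : EuclideanSpace ℝ (Fin 3)} (hw : w ∈ fccSlots) :
    |w 2| ≤ Real.sqrt (2 / 3) := by
  obtain ⟨k, i, j, hkw⟩ := mem_fcc_of_mem_fccSlots hw
  have hs : 0 < Real.sqrt (2 / 3) := Real.sqrt_pos.2 (by norm_num)
  have hs2 : Real.sqrt (2 / 3) ^ 2 = 2 / 3 := Real.sq_sqrt (by norm_num)
  have hw2 : w 2 = (k : ℝ) * Real.sqrt (2 / 3) := by rw [hkw, barlowPos_apply_two]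
  have habs : |w 2| ≤ 1 := by
    have h := abs_apply_sub_le_dist w 0 2
    rw [dist_eq_norm, sub_zero, norm_eq_one_of_mem_fccSlots hw] at h
    simpa using h
  have hk1 : (k : ℝ) ^ 2 ≤ 1 := by
    have h1 : (w 2) ^ 2 ≤ 1 := by
      have := sq_le_sq' (abs_le.1 habs).1 (abs_le.1 habs).2; simpa using this
    rw [hw2, mul_pow, hs2] at h1
    have : ((k : ℤ) : ℝ) ^ 2 ≤ 3 / 2 := by linarith
    have hk : (k : ℤ) ^ 2 ≤ 1 := by
      by_contra hcon
      push Not at hcon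
      have : (2 : ℤ) ≤ k ^ 2 := hcon
      have : (2 : ℝ) ≤ ((k : ℤ) : ℝ) ^ 2 := by exact_mod_cast this
      linarith
    exact_mod_cast hk
  rw [hw2, abs_mul, abs_of_pos hs]
  have : |(k : ℝ)| ≤ 1 := by
    rw [← Real.sqrt_sq_eq_abs]
    calc Real.sqrt ((k : ℝ) ^ 2) ≤ Real.sqrt 1 := Real.sqrt_le_sqrt hk1
      _ = 1 := Real.sqrt_one
  nlinarith

/-- **A face with a horizontal vertex is not a basal face**: its cubic sum is not `±(−2, 2, 2)`
(for such a sum the face sum would be `±√6 e₃`, but `|(w₁+w₂+w₃)₂| ≤ 2√(2/3) < √6`). -/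
theorem faceSum_not_vertical (A B C : EuclideanSpace ℝ (Fin 3) → ℝ)
    (hA : ∀ x, A x = x 0 + Real.sqrt 3 / 3 * x 1 - Real.sqrt (2 / 3) * x 2)
    (hB : ∀ x, B x = x 0 - Real.sqrt 3 / 3 * x 1 + Real.sqrt (2 / 3) * x 2)
    (hC : ∀ x, C x = 2 * Real.sqrt 3 / 3 * x 1 + Real.sqrt (2 / 3) * x 2)
    {w₁ w₂ w₃ : EuclideanSpace ℝ (Fin 3)} (h₂ : w₂ ∈ fccSlots) (h₃ : w₃ ∈ fccSlots)
    (hw₁ : w₁ 2 = 0) (σ : ℝ) (hσ : σ = 1 ∨ σ = -1) :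
    ¬ (A (w₁ + w₂ + w₃) = -2 * σ ∧ B (w₁ + w₂ + w₃) = 2 * σ ∧ C (w₁ + w₂ + w₃) = 2 * σ) := by
  rintro ⟨ha, hb, hc⟩
  have hs : 0 < Real.sqrt (2 / 3) := Real.sqrt_pos.2 (by norm_num)
  have key := apply_two_eq_cubic A B C hA hB hC (w₁ + w₂ + w₃)
  rw [ha, hb, hc] at key
  -- `3 √(2/3) (w₁+w₂+w₃)₂ = 6σ`, so `|(w₁+w₂+w₃)₂| = 2/√(2/3)·… = 3·√(2/3)·|σ|·…`
  have hsum : (w₁ + w₂ + w₃) 2 = w₁ 2 + w₂ 2 + w₃ 2 := by simp only [PiLp.add_apply]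
  rw [hsum, hw₁, zero_add] at key
  have h2 := abs_apply_two_le_of_mem_fccSlots h₂
  have h3 := abs_apply_two_le_of_mem_fccSlots h₃
  have hb2 := abs_le.1 h2
  have hb3 := abs_le.1 h3
  have hs2 : Real.sqrt (2 / 3) ^ 2 = 2 / 3 := Real.sq_sqrt (by norm_num)
  rcases hσ with rfl | rfl <;> nlinarith

end Summit.Ventures.Crystal3D.Theorems

end
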